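import Summits.NavierStokesRegularity.NavierStokesRegularity.Theorems.StrainDoorsDefs
import Literature.Analysis.FluidPDE.LeraySelfSimilarCalculus
import Literature.Analysis.FluidPDE.NSSuitableESSRefutation
import HarnessLib

/-!
# StrainDoorsLerayRecordLinear — the LINEAR STRAIN BLOW-UP `u = Mx/(2a(T−t))` is an exact classical solution and attains
# the defect–lifespan constant of door D12 (ROUND-51 PART B; nsreg-p1 g34)

For a symmetric, divergence-free (trace-free) linear map `M` of `ℝ³` the pair `U = M`, `P(y) = −(a⟪y,My⟫ + ½|My|²)` is a smooth
Leray profile (`linearStrain_isLerayProfile`), so Leray's backward field `u = lerayBackward a T M`, i.e. `u(x,t) = Mx/(2a(T−t))`,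
`p = lerayBackwardPressure a T P`, is a classical Navier–Stokes solution on `ℝ³ × (−∞,T)` (`lerayBackward_isClassical_iff_holds`;
infinite energy).  Along a unit eigenvector `Me = σe`, `σ > 0`, at every `x` and every `t < T` (`linearStrain_defect_number_eq_one`):
the strain form is `q = σ/(2a(T−t))`, the feed is `H = (2aσ + σ²)/(2a(T−t))²` (no vorticity: `curl_clm_eq_zero_of_symm`), and
`((H − q²)/q²)·((T − t)·q) = 1` EXACTLY — the inequality form `(c − 1)·Λ(t₀)·(T − t₀) ≥ 1` of the defect–lifespan law (`defect_lifespan_law`,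
`Theorems/StrainDoorsDefectLifespanDoor`) holds with EQUALITY on every window for this exact (infinite-energy) solution.  HONEST LABEL
(referee F6, R50 score): the field violates D12's frame hypothesis `HasBoundedSobolevNormsOn` (infinite energy), so this is an extremiser
of the MODEL CLOCK (record differential inequality + door Λ), NOT of D12 inside D12's hypotheses; sharpness of D12 inside its
finite-energy frame is open.  No new definitions; no sorry.
-/

noncomputable section

open MeasureTheory Set Function Filter Metric Real InnerProductSpace
open _root_.Topology
open scoped ENNReal NNReal RealInnerProductSpace ContDiff Laplacian
open Literature.Analysis Literature.Analysis.FluidPDE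
open Literature.Analysis.FluidPDE.VorticityDirectionDynamics

set_option linter.dupNamespace false

namespace Summit.NavierStokesRegularity.NavierStokesRegularity.Theorems.StrainDoors

open Summit.NavierStokesRegularity.NavierStokesRegularity.Theorems.ArgmaxDoors

/-! ## §B1 The linear Leray profile -/

/-- The gradient of the linear-strain pressure profile `P(y) = −(a⟪y,My⟫ + ½⟪My,My⟫)` for a symmetric `M`:
`∇P(y) = −(2a•My + M(My))`. [folklore] -/
theorem gradient_linearStrainPressure (M : EuclideanSpace ℝ (Fin 3) →L[ℝ] EuclideanSpace ℝ (Fin 3))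
    (hsym : ∀ x y, ⟪M x, y⟫ = ⟪x, M y⟫) (a : ℝ) (y : EuclideanSpace ℝ (Fin 3)) :
    gradient (fun z => -(a * ⟪z, M z⟫ + (1 / 2) * ⟪M z, M z⟫)) y = -((2 * a) • M y + M (M y)) := by
  apply HasGradientAt.gradient
  rw [hasGradientAt_iff_hasFDerivAt]
  have hI : HasFDerivAt (fun z : EuclideanSpace ℝ (Fin 3) => z) (ContinuousLinearMap.id ℝ _) y := hasFDerivAt_id y
  have hM : HasFDerivAt (fun z => M z) M y := M.hasFDerivAt
  have h1 := hI.inner ℝ hM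
  have h2 := hM.inner ℝ hM
  have h3 := ((h1.const_mul a).add (h2.const_mul (1 / 2 : ℝ))).neg
  refine h3.congr_fderiv (ContinuousLinearMap.ext fun w => ?_)
  rw [InnerProductSpace.toDual_apply_apply]
  simp only [_root_.neg_apply, _root_.add_apply, FunLike.coe_smul,
    Pi.smul_apply, ContinuousLinearMap.coe_comp, Function.comp_apply, ContinuousLinearMap.prod_apply,
    fderivInnerCLM_apply, ContinuousLinearMap.coe_id', id_eq, smul_eq_mul]
  rw [inner_neg_left, inner_add_left, real_inner_smul_left, hsym (M y) w, ← hsym y w, real_inner_comm (M y) w,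
    real_inner_comm (M y) (M w)]
  ring

/-- ★ **The linear strain profile is a Leray profile**: for a symmetric, divergence-free linear map `M` of `ℝ³` and any `ν`, `a`,
`(U, P) = (M, −(a⟪y,My⟫ + ½|My|²))` solves `−νΔU + aU + a(y·∇)U + (U·∇)U + ∇P = 0`, `div U = 0`. [folklore] -/
theorem linearStrain_isLerayProfile (M : EuclideanSpace ℝ (Fin 3) →L[ℝ] EuclideanSpace ℝ (Fin 3))
    (hsym : ∀ x y, ⟪M x, y⟫ = ⟪x, M y⟫) (hdiv : VectorCalculus.IsDivFree (M : EuclideanSpace ℝ (Fin 3) → EuclideanSpace ℝ (Fin 3)))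
    (ν a : ℝ) :
    IsLerayProfile ν a (M : EuclideanSpace ℝ (Fin 3) → EuclideanSpace ℝ (Fin 3))
      (fun z => -(a * ⟪z, M z⟫ + (1 / 2) * ⟪M z, M z⟫)) where
  contDiff_velocity := M.contDiff
  contDiff_pressure := by
    have hM1 : ContDiff ℝ 1 (fun z => M z) := M.contDiff
    exact ((contDiff_const.mul (contDiff_id.inner ℝ hM1)).add (contDiff_const.mul (hM1.inner ℝ hM1))).neg
  profile_eq := fun y => by
    rw [laplacian_clm_apply, convect_clm_apply, ContinuousLinearMap.fderiv, gradient_linearStrainPressure M hsym a y,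
      smul_zero, neg_zero, zero_add, two_mul, add_smul]
    abel
  divFree := hdiv

/-! ## §B2 No vorticity, and the defect–lifespan number of the linear strain blow-up -/

/-- A symmetric linear field is irrotational: `curl M ≡ 0`. [folklore] -/
theorem curl_clm_eq_zero_of_symm (N : EuclideanSpace ℝ (Fin 3) →L[ℝ] EuclideanSpace ℝ (Fin 3))
    (hsym : ∀ x y, ⟪N x, y⟫ = ⟪x, N y⟫) (x : EuclideanSpace ℝ (Fin 3)) :
    curl (N : EuclideanSpace ℝ (Fin 3) → EuclideanSpace ℝ (Fin 3)) x = 0 := by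
  have hc : ∀ i j : Fin 3, (N (EuclideanSpace.single j (1 : ℝ))) i = (N (EuclideanSpace.single i (1 : ℝ))) j := by
    intro i j
    have h1 : (N (EuclideanSpace.single j (1 : ℝ))) i = ⟪N (EuclideanSpace.single j (1 : ℝ)), EuclideanSpace.single i (1 : ℝ)⟫ := by
      rw [EuclideanSpace.inner_single_right]; simp
    have h2 : (N (EuclideanSpace.single i (1 : ℝ))) j = ⟪EuclideanSpace.single j (1 : ℝ), N (EuclideanSpace.single i (1 : ℝ))⟫ := by
      rw [EuclideanSpace.inner_single_left]; simp
    rw [h1, h2, hsym]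
  simp only [curl, ContinuousLinearMap.fderiv]
  rw [hc 2 1, hc 0 2, hc 1 0, sub_self, sub_self, sub_self]
  ext k
  fin_cases k <;> simp

/-- ★ **THE LINEAR STRAIN BLOW-UP ATTAINS THE CONSTANT OF THE MODEL CLOCK** (the inequality form of D12's law; the field is OUTSIDE D12's
finite-energy frame — referee F6).  Let `M` be symmetric, `Me = σe` with `|e| = 1`, `σ > 0`, `a > 0`,
`t < T`, and let `u = lerayBackward a T M` (`= Mx/(2a(T−t))`), `p = lerayBackwardPressure a T P` with the linear-strain pressure profile.
Then at every `x`: `((H − q²)/q²)·((T − t)·q) = 1` with `q = strainQuad u t x e`, `H = strainFeed u p t x e` — the record defect times the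
strain number is IDENTICALLY one (R50 `defect_lifespan_law`: blow-up forces it `≥ 1`, up to the budget factor). [folklore] -/
theorem linearStrain_defect_number_eq_one (M : EuclideanSpace ℝ (Fin 3) →L[ℝ] EuclideanSpace ℝ (Fin 3))
    (hsym : ∀ x y, ⟪M x, y⟫ = ⟪x, M y⟫) {a T t σ : ℝ} (ha : 0 < a) (ht : t < T) (hσ : 0 < σ)
    {e : EuclideanSpace ℝ (Fin 3)} (he : ‖e‖ = 1) (hMe : M e = σ • e) (x : EuclideanSpace ℝ (Fin 3)) :
    (strainFeed (lerayBackward a T (M : EuclideanSpace ℝ (Fin 3) → EuclideanSpace ℝ (Fin 3)))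
        (lerayBackwardPressure a T (fun z => -(a * ⟪z, M z⟫ + (1 / 2) * ⟪M z, M z⟫))) t x e -
      (strainQuad (lerayBackward a T (M : EuclideanSpace ℝ (Fin 3) → EuclideanSpace ℝ (Fin 3))) t x e) ^ 2) /
      (strainQuad (lerayBackward a T (M : EuclideanSpace ℝ (Fin 3) → EuclideanSpace ℝ (Fin 3))) t x e) ^ 2 *
      ((T - t) * strainQuad (lerayBackward a T (M : EuclideanSpace ℝ (Fin 3) → EuclideanSpace ℝ (Fin 3))) t x e) = 1 := by
  -- abbreviations
  obtain ⟨P, hP⟩ : ∃ P : EuclideanSpace ℝ (Fin 3) → ℝ, P = fun z => -(a * ⟪z, M z⟫ + (1 / 2) * ⟪M z, M z⟫) := ⟨_, rfl⟩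
  rw [show (fun z => -(a * ⟪z, M z⟫ + (1 / 2) * ⟪M z, M z⟫)) = P from hP.symm]
  obtain ⟨L, hL⟩ : ∃ L : ℝ, L = (Real.sqrt (2 * a * (T - t)))⁻¹ := ⟨_, rfl⟩
  have hL2 : L ^ 2 = (2 * a * (T - t))⁻¹ := by rw [hL]; exact lerayScale_sq ha ht
  have hLpos : 0 < L := by rw [hL]; exact lerayScale_pos ha ht
  have hee : ⟪e, e⟫ = 1 := by rw [real_inner_self_eq_norm_sq, he, one_pow]
  -- the strain form: q = L² σ
  have hq : strainQuad (lerayBackward a T (M : EuclideanSpace ℝ (Fin 3) → EuclideanSpace ℝ (Fin 3))) t x e = L ^ 2 * σ := by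
    unfold strainQuad
    rw [fderiv_lerayBackward, ContinuousLinearMap.fderiv, _root_.smul_apply, real_inner_smul_left, hMe, real_inner_smul_left,
      hee, mul_one, hL]
  -- the slice `u t` is the symmetric linear map `L² • M`: no vorticity
  have hslice : lerayBackward a T (M : EuclideanSpace ℝ (Fin 3) → EuclideanSpace ℝ (Fin 3)) t =
      ((L ^ 2 • M : EuclideanSpace ℝ (Fin 3) →L[ℝ] EuclideanSpace ℝ (Fin 3)) : EuclideanSpace ℝ (Fin 3) → EuclideanSpace ℝ (Fin 3)) := by
    funext z
    simp only [lerayBackward, FunLike.coe_smul, Pi.smul_apply, map_smul, smul_smul, ← hL, sq]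
  have hsym2 : ∀ x y, ⟪(L ^ 2 • M) x, y⟫ = ⟪x, (L ^ 2 • M) y⟫ := by
    intro x y
    simp only [FunLike.coe_smul, Pi.smul_apply, real_inner_smul_left, real_inner_smul_right, hsym]
  have hcurl : curl (lerayBackward a T (M : EuclideanSpace ℝ (Fin 3) → EuclideanSpace ℝ (Fin 3)) t) x = 0 := by
    rw [hslice]; exact curl_clm_eq_zero_of_symm _ hsym2 x
  -- the pressure Hessian: gradient (p t) z = −L⁴ (2a M z + M (M z))
  have hgradP : gradient (lerayBackwardPressure a T P t) =
      fun z => ((-(L ^ 4) • ((2 * a) • M + M.comp M) : EuclideanSpace ℝ (Fin 3) →L[ℝ] EuclideanSpace ℝ (Fin 3)) z) := by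
    funext z
    rw [lerayBackwardPressure_eq_of_lt ha ht, gradient_lerayBackwardPressure_sub, ← hL, hP, gradient_linearStrainPressure M hsym a]
    simp only [FunLike.coe_smul, Pi.smul_apply, _root_.add_apply, ContinuousLinearMap.coe_comp, Function.comp_apply, map_smul]
    module
  have hH : pressureHess (lerayBackwardPressure a T P) t x e = -(L ^ 4) * (2 * a * σ + σ ^ 2) := by
    unfold pressureHess
    rw [hgradP, ContinuousLinearMap.fderiv]
    simp only [FunLike.coe_smul, Pi.smul_apply, _root_.add_apply, ContinuousLinearMap.coe_comp,
      Function.comp_apply, hMe, map_smul, real_inner_smul_left, inner_add_left, hee]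
    ring
  have hfeed : strainFeed (lerayBackward a T (M : EuclideanSpace ℝ (Fin 3) → EuclideanSpace ℝ (Fin 3)))
      (lerayBackwardPressure a T P) t x e = L ^ 4 * (2 * a * σ + σ ^ 2) := by
    unfold strainFeed
    rw [hcurl, hH, norm_zero, inner_zero_left]
    ring
  rw [hfeed, hq]
  have hTt : 0 < T - t := sub_pos.2 ht
  have hL4 : L ^ 4 = L ^ 2 * L ^ 2 := by ring
  rw [hL4, hL2]
  field_simp
  ring

end Summit.NavierStokesRegularity.NavierStokesRegularity.Theorems.StrainDoors
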